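import Literature.Probability.Percolation.BlockExploration
import Literature.Probability.Percolation.SlabCriticality
import Literature.Probability.Percolation.HarrisTheorem
import Literature.Probability.Percolation.BKFinitary
import HarnessLib

/-!
# Exploration of the open clusters of a block from an inner set: the combinatorial API (proved)

Topic `Literature/Probability/Percolation`; companion of the definitions file
`BlockExploration.lean` (`explSet`, `explRim`, `explEvent`, `explRimLinked`, `explRimWired`).
D. Basu, A. Sapozhnikov, ECP 22 (2017), §2, explore in a configuration `ω` the open clusters of a
block `Blk` from the inner set `In`: the explored set `𝒞 = explSet In Blk ω ⊇ In` (the vertices of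
`Blk` joined to `In` by an open path inside `In ∪ Blk`) and its rim `𝒟 = explRim In Blk ω` (the
vertices outside `𝒞` attached to it by an open edge). Everything below is proved; no definitions.

* Structure: `𝒞` is closed under open paths inside `In ∪ Blk` (`openConnIn_explSet_of_mem_explSet`),
  `𝒟 ∩ (In ∪ Blk) = ∅` (`explRim_disjoint`), every open edge leaving `𝒞` ends in `𝒟`
  (`mem_explSet_or_explRim_of_open_edge`), `𝒟 = ∅` iff no open edge leads from `𝒞` out of
  `In ∪ Blk` (`explRim_eq_empty_iff`).
* (E2) `mem_explEvent_iff_of_agree_on_touching`: the datum event `explEvent In Blk U R`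
  (`{𝒞 = U, 𝒟 = R}`) is determined by the edges touching `U` (first exit from `U` of an exploring
  path); (E3) `mem_explEvent_iff_of_agree_on_block`: even by the edges touching `Blk`, provided
  no open edge leads from `In` directly out of `In ∪ Blk` (cut an exploring path at its LAST vertex
  in `In`).
* (E5) `explRimWired_of_separating`, `explRimLinked_of_separating`: if `P ⊆ Blk`, pairwise
  open-connected inside `In ∪ Blk`, meets every open walk from `In` to the outside of `In ∪ Blk`,
  then any two rim vertices hang, through their open edges, off two explored vertices joined INSIDE
  `𝒞` (Basu–Sapozhnikov's use of the uniqueness event `Fᵢ`; in the plane `P` is an open circuit).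
* (E7) `openConn_iff_of_mem_explEvent`: on `explEvent In Blk U R` with linked rim, for `x ∈ U`,
  `t ∉ U`: `x ↔ t` iff `x` is joined INSIDE `U` to a vertex carrying an open edge to the rim (the
  piece before the first exit from `U`) and some rim vertex is joined to `t` by an open path
  AVOIDING `U` (the piece after the last visit to `U`); conversely the pieces are glued through the
  linked rim — the event algebra of the domain Markov decoupling at `𝒞`, without planarity.

## References
* [BasuSapozhnikov2017ECP] D. Basu, A. Sapozhnikov, *Kesten's incipient infinite cluster and
  quasi-multiplicativity of crossing probabilities*, Electron. Commun. Probab. 22 (2017) no. 26,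
  §2, eq. (2.3) and the paragraph after it.
* H. Kesten, Probab. Theory Related Fields 73 (1986) 369–394, §2 (the planar prototype).
-/

namespace Literature.Probability.Percolation

open SimpleGraph

variable {V : Type*}

/-! ### Generic tools: transfer of open paths, walks in the open graph
(the edges of a walk in the open graph are open: `mem_of_mem_walk_edges`, `BKFinitary.lean`) -/

namespace BlockExploration

/-- A chain inside `A` in `G` is a chain inside `A` in any graph `G'` containing the edges of `G`
between vertices of `A`. [folklore] -/
theorem pathIn_of_adj_imp {G G' : SimpleGraph V} {A : Set V} {u v : V} (h : PathIn G A u v)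
    (hGG' : ∀ a ∈ A, ∀ b ∈ A, G.Adj a b → G'.Adj a b) : PathIn G' A u v := by
  obtain ⟨hu, h⟩ := h
  refine ⟨hu, ?_⟩
  induction h with
  | refl => exact Relation.ReflTransGen.refl
  | @tail b c hub hbc ih =>
    exact ih.tail ⟨hGG' b (show PathIn G A u b from ⟨hu, hub⟩).right_mem c hbc.2 hbc.1, hbc.2⟩

/-- **Locality of `{u ↔ v in A}`.** If every `ω₁`-open edge with both endpoints in `A` is
`ω₂`-open, then `{u ↔ v in A}` passes from `ω₁` to `ω₂`. [folklore] -/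
theorem openConnIn_of_agree {ω₁ ω₂ : BondConfig V} {A : Set V} {u v : V}
    (h : ω₁ ∈ openConnIn A u v) (hagree : ∀ a ∈ A, ∀ b ∈ A, s(a, b) ∈ ω₁ → s(a, b) ∈ ω₂) :
    ω₂ ∈ openConnIn A u v := by
  rw [mem_openConnIn_iff_pathIn] at h ⊢
  exact pathIn_of_adj_imp h fun a ha b hb hab => by
    rw [openGraph_adj] at hab ⊢
    exact ⟨hagree a ha b hb hab.1, hab.2⟩

/-- `{x ↔ y in S}` is witnessed by a walk of the open graph all of whose vertices lie in `S`.
[folklore] -/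
theorem exists_openWalk_of_mem_openConnIn {ω : BondConfig V} {S : Set V} {x y : V}
    (h : ω ∈ openConnIn S x y) : ∃ p : (openGraph ω).Walk x y, ∀ z ∈ p.support, z ∈ S := by
  obtain ⟨hx, hy, ⟨q⟩⟩ := h
  refine ⟨(q.map (Embedding.induce S).toHom).copy rfl rfl, fun z hz => ?_⟩
  rw [Walk.support_copy, Walk.support_map] at hz
  obtain ⟨w, -, rfl⟩ := List.mem_map.1 hz
  exact w.2

/-- `{x ↔ y} = {x ↔ y in univ}`. [folklore] -/
theorem mem_openConn_iff_openConnIn_univ {ω : BondConfig V} {x y : V} :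
    ω ∈ openConn x y ↔ ω ∈ openConnIn Set.univ x y := by
  refine ⟨fun h => openConnIn_univ_of_reachable h, fun h => ?_⟩
  obtain ⟨p, -⟩ := exists_openWalk_of_mem_openConnIn h
  exact ⟨p⟩

end BlockExploration

open BlockExploration

/-! ### Structure of the explored set and of the rim -/

/-- `v` is explored iff `v ∈ In ∪ Blk` and `v` is joined to a vertex of `In` by an open path inside
`In ∪ Blk` (for `v ∈ In` take the trivial path). [cite: BasuSapozhnikov2017ECP, §2 eq. (2.3)] -/
theorem mem_explSet_iff_exists {In Blk : Set V} {ω : BondConfig V} {v : V} :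
    v ∈ explSet In Blk ω ↔ v ∈ In ∪ Blk ∧ ∃ u ∈ In, ω ∈ openConnIn (In ∪ Blk) u v :=
  ⟨fun h => h.elim (fun hv => ⟨Or.inl hv, v, hv, openConnIn_refl (Or.inl hv)⟩)
      fun ⟨hv, u, hu, h⟩ => ⟨Or.inr hv, u, hu, h⟩,
    fun ⟨hv, u, hu, h⟩ => hv.elim Or.inl fun hv => Or.inr ⟨hv, u, hu, h⟩⟩

/-- **The explored set is closed under open paths inside `In ∪ Blk`.**
[cite: BasuSapozhnikov2017ECP, §2 eq. (2.3)] -/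
theorem mem_explSet_of_openConnIn {In Blk : Set V} {ω : BondConfig V} {v w : V}
    (hv : v ∈ explSet In Blk ω) (h : ω ∈ openConnIn (In ∪ Blk) v w) : w ∈ explSet In Blk ω := by
  obtain ⟨-, u, hu, huv⟩ := mem_explSet_iff_exists.1 hv
  exact mem_explSet_iff_exists.2 ⟨h.2.1, u, hu, PlanarDuality.openConnIn_trans huv h⟩

/-- An open edge from an explored vertex to a vertex of `In ∪ Blk` ends in the explored set.
[cite: BasuSapozhnikov2017ECP, §2 eq. (2.3)] -/
theorem mem_explSet_of_open_edge {In Blk : Set V} {ω : BondConfig V} {v w : V}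
    (hv : v ∈ explSet In Blk ω) (he : s(v, w) ∈ ω) (hw : w ∈ In ∪ Blk) : w ∈ explSet In Blk ω := by
  by_cases hvw : v = w
  · exact hvw ▸ hv
  · exact mem_explSet_of_openConnIn hv (openConnIn_of_adj (explSet_subset In Blk ω hv) hw he hvw)

/-- An open path inside `In ∪ Blk` from an explored vertex runs inside the explored set.
[cite: BasuSapozhnikov2017ECP, §2 eq. (2.3)] -/
theorem openConnIn_explSet_of_mem_explSet {In Blk : Set V} {ω : BondConfig V} {v w : V}
    (hv : v ∈ explSet In Blk ω) (h : ω ∈ openConnIn (In ∪ Blk) v w) :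
    ω ∈ openConnIn (explSet In Blk ω) v w := by
  rw [mem_openConnIn_iff_pathIn] at h ⊢
  obtain ⟨-, h⟩ := h
  refine ⟨hv, ?_⟩
  induction h with
  | refl => exact Relation.ReflTransGen.refl
  | @tail b c _ hbc ih =>
    have hb : b ∈ explSet In Blk ω := (show PathIn (openGraph ω) _ v b from ⟨hv, ih⟩).right_mem
    exact ih.tail ⟨hbc.1, mem_explSet_of_open_edge hb ((openGraph_adj ω b c).1 hbc.1).1 hbc.2⟩

/-- **The rim lies outside `In ∪ Blk`** (an open edge from the explored set into `In ∪ Blk` would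
explore its endpoint). [cite: BasuSapozhnikov2017ECP, §2 eq. (2.3) ("𝒟ᵢ ⊆ B(v,Nᵢ')ᶜ")] -/
theorem explRim_disjoint {In Blk : Set V} {ω : BondConfig V} {w : V} (hw : w ∈ explRim In Blk ω) :
    w ∉ In ∪ Blk := by
  obtain ⟨hwE, v, hv, hvw⟩ := mem_explRim_iff.1 hw
  exact fun hwIB => hwE (mem_explSet_of_open_edge hv hvw hwIB)

/-- The explored set and the rim are disjoint. [cite: BasuSapozhnikov2017ECP, §2 eq. (2.3)] -/
theorem disjoint_explSet_explRim (In Blk : Set V) (ω : BondConfig V) :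
    Disjoint (explSet In Blk ω) (explRim In Blk ω) :=
  Set.disjoint_left.2 fun _ hv hw => (mem_explRim_iff.1 hw).1 hv

/-- **Every open edge leaving the explored set ends in the rim.**
[cite: BasuSapozhnikov2017ECP, §2 eq. (2.3)] -/
theorem mem_explSet_or_explRim_of_open_edge {In Blk : Set V} {ω : BondConfig V} {v w : V}
    (hv : v ∈ explSet In Blk ω) (he : s(v, w) ∈ ω) :
    w ∈ explSet In Blk ω ∨ w ∈ explRim In Blk ω := by
  by_cases hw : w ∈ explSet In Blk ω
  · exact Or.inl hw
  · exact Or.inr (mem_explRim_iff.2 ⟨hw, v, hv, he⟩)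

/-- On the datum event `{𝒞 = U, 𝒟 = R}`, an open edge from `U` to a vertex outside `U` ends in `R`.
[cite: BasuSapozhnikov2017ECP, §2, definition of F_i(U,R)] -/
theorem mem_of_mem_explEvent_of_open_edge {In Blk U R : Set V} {ω : BondConfig V}
    (hω : ω ∈ explEvent In Blk U R) {v w : V} (hv : v ∈ U) (he : s(v, w) ∈ ω) (hw : w ∉ U) :
    w ∈ R := by
  obtain ⟨rfl, rfl⟩ := mem_explEvent_iff.1 hω
  exact (mem_explSet_or_explRim_of_open_edge hv he).resolve_left hw

/-- **The rim is empty iff no open edge leads from the explored set out of `In ∪ Blk`.**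
[cite: BasuSapozhnikov2017ECP, §2 eq. (2.3)] -/
theorem explRim_eq_empty_iff {In Blk : Set V} {ω : BondConfig V} :
    explRim In Blk ω = ∅ ↔ ¬ ∃ v ∈ explSet In Blk ω, ∃ w ∉ In ∪ Blk, s(v, w) ∈ ω := by
  rw [Set.eq_empty_iff_forall_notMem]
  refine ⟨fun h ⟨v, hv, w, hw, hvw⟩ => ?_, fun h w hw => ?_⟩
  · exact h w (mem_explRim_iff.2 ⟨fun hwE => hw (explSet_subset In Blk ω hwE), v, hv, hvw⟩)
  · obtain ⟨-, v, hv, hvw⟩ := mem_explRim_iff.1 hw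
    exact h ⟨v, hv, w, explRim_disjoint hw, hvw⟩

/-! ### (E2) The datum event is determined by the edges touching the explored set -/

/-- If `explSet In Blk ω₁ = U` and `ω₂` agrees with `ω₁` on the edges touching `U`, then
`explSet In Blk ω₂ = U`: exploring paths of `ω₁` run inside `U`, hence are `ω₂`-open; an exploring
path of `ω₂` leaving `U` would do so along an edge touching `U`, open in `ω₁`, whose far endpoint
`ω₁` would have explored (first exit from `U`).
[cite: BasuSapozhnikov2017ECP, §2, paragraph after eq. (2.3)] -/
theorem explSet_eq_of_agree_on_touching {In Blk U : Set V} {ω₁ ω₂ : BondConfig V}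
    (hagree : ∀ e : Sym2 V, (∃ v ∈ U, v ∈ e) → (e ∈ ω₁ ↔ e ∈ ω₂))
    (h₁ : explSet In Blk ω₁ = U) : explSet In Blk ω₂ = U := by
  subst h₁
  have hag : ∀ a ∈ explSet In Blk ω₁, ∀ b : V, (s(a, b) ∈ ω₁ ↔ s(a, b) ∈ ω₂) :=
    fun a ha b => hagree _ ⟨a, ha, Sym2.mem_mk_left a b⟩
  refine Set.Subset.antisymm (fun v hv => ?_) (fun v hv => ?_)
  · -- an exploring path of `ω₂` cannot leave `explSet ω₁`: look at its first exit
    by_contra hvU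
    obtain ⟨-, u, hu, huv⟩ := mem_explSet_iff_exists.1 hv
    rw [mem_openConnIn_iff_pathIn] at huv
    obtain ⟨a, b, ha, hb, hbS, hab, -⟩ := huv.exit (subset_explSet In Blk ω₁ hu) hvU
    rw [openGraph_adj] at hab
    exact hb (mem_explSet_of_open_edge ha ((hag a ha b).2 hab.1) hbS)
  · -- an exploring path of `ω₁` runs inside `explSet ω₁`, hence is `ω₂`-open
    obtain ⟨hvS, u, hu, huv⟩ := mem_explSet_iff_exists.1 hv
    have huv₂ : ω₂ ∈ openConnIn (explSet In Blk ω₁) u v :=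
      openConnIn_of_agree (openConnIn_explSet_of_mem_explSet (subset_explSet In Blk ω₁ hu) huv)
        fun a ha b _ hab => (hag a ha b).1 hab
    exact mem_explSet_iff_exists.2 ⟨hvS, u, hu, openConnIn_mono (explSet_subset In Blk ω₁) _ _ huv₂⟩

/-- With the same explored set `U`, configurations agreeing on the edges touching `U` have the same
rim. [cite: BasuSapozhnikov2017ECP, §2, paragraph after eq. (2.3)] -/
theorem explRim_eq_of_agree_on_touching {In Blk U : Set V} {ω₁ ω₂ : BondConfig V}
    (hagree : ∀ e : Sym2 V, (∃ v ∈ U, v ∈ e) → (e ∈ ω₁ ↔ e ∈ ω₂))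
    (h₁ : explSet In Blk ω₁ = U) (h₂ : explSet In Blk ω₂ = U) :
    explRim In Blk ω₁ = explRim In Blk ω₂ := by
  ext w
  rw [mem_explRim_iff, mem_explRim_iff, h₁, h₂]
  exact and_congr_right fun _ => exists_congr fun v => and_congr_right fun hv =>
    hagree _ ⟨v, hv, Sym2.mem_mk_left v w⟩

/-- **(E2) The datum event `{𝒞 = U, 𝒟 = R}` is determined by the edges touching `U`.**
[cite: BasuSapozhnikov2017ECP, §2, paragraph after eq. (2.3)] -/
theorem mem_explEvent_iff_of_agree_on_touching {In Blk U R : Set V} {ω₁ ω₂ : BondConfig V}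
    (hagree : ∀ e : Sym2 V, (∃ v ∈ U, v ∈ e) → (e ∈ ω₁ ↔ e ∈ ω₂)) :
    ω₁ ∈ explEvent In Blk U R ↔ ω₂ ∈ explEvent In Blk U R := by
  rw [mem_explEvent_iff, mem_explEvent_iff]
  refine ⟨fun ⟨h₁, hR⟩ => ?_, fun ⟨h₂, hR⟩ => ?_⟩
  · have h₂ := explSet_eq_of_agree_on_touching hagree h₁
    exact ⟨h₂, (explRim_eq_of_agree_on_touching hagree h₁ h₂).symm.trans hR⟩
  · have h₁ := explSet_eq_of_agree_on_touching (fun e he => (hagree e he).symm) h₂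
    exact ⟨h₁, (explRim_eq_of_agree_on_touching hagree h₁ h₂).trans hR⟩

/-! ### (E3) Determinacy by the edges touching the block -/

/-- If `ω₂` agrees with `ω₁` on the edges touching `Blk`, then
`explSet In Blk ω₁ ⊆ explSet In Blk ω₂`: cut an exploring path at its LAST vertex `a` in `In`; the
remainder runs in `Blk ∖ In`, so it and the edge leaving `a` touch `Blk`.
[cite: BasuSapozhnikov2017ECP, §2, paragraph after eq. (2.3)] -/
theorem explSet_subset_explSet_of_agree_on_block {In Blk : Set V} {ω₁ ω₂ : BondConfig V}
    (hagree : ∀ e : Sym2 V, (∃ v ∈ Blk, v ∈ e) → (e ∈ ω₁ ↔ e ∈ ω₂)) :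
    explSet In Blk ω₁ ⊆ explSet In Blk ω₂ := by
  rintro v (hvIn | ⟨hvBlk, u, hu, huv⟩)
  · exact Or.inl hvIn
  by_cases hvIn : v ∈ In
  · exact Or.inl hvIn
  refine Or.inr ⟨hvBlk, ?_⟩
  rw [mem_openConnIn_iff_pathIn] at huv
  obtain ⟨a, b, haIn, -, hbIn, hab, hbv⟩ := huv.last_exit hu hvIn
  have hbS : b ∈ In ∪ Blk := hbv.left_mem.1
  have hbBlk : b ∈ Blk := hbS.resolve_left hbIn
  refine ⟨a, haIn, ?_⟩
  rw [mem_openConnIn_iff_pathIn]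
  have hab₂ : (openGraph ω₂).Adj a b := by
    rw [openGraph_adj] at hab ⊢
    exact ⟨(hagree _ ⟨b, hbBlk, Sym2.mem_mk_right a b⟩).1 hab.1, hab.2⟩
  have hbv₂ : PathIn (openGraph ω₂) ((In ∪ Blk) \ In) b v :=
    pathIn_of_adj_imp hbv fun c hc d _ hcd => by
      rw [openGraph_adj] at hcd ⊢
      exact ⟨(hagree _ ⟨c, hc.1.resolve_left hc.2, Sym2.mem_mk_left c d⟩).1 hcd.1, hcd.2⟩
  have hab' : PathIn (openGraph ω₂) (In ∪ Blk) a b := PathIn.of_adj (Or.inl haIn) hbS hab₂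
  exact hab'.trans (hbv₂.mono fun z hz => hz.1)

/-- Configurations agreeing on the edges touching `Blk` have the same explored set.
[cite: BasuSapozhnikov2017ECP, §2, paragraph after eq. (2.3)] -/
theorem explSet_eq_of_agree_on_block {In Blk : Set V} {ω₁ ω₂ : BondConfig V}
    (hagree : ∀ e : Sym2 V, (∃ v ∈ Blk, v ∈ e) → (e ∈ ω₁ ↔ e ∈ ω₂)) :
    explSet In Blk ω₁ = explSet In Blk ω₂ :=
  (explSet_subset_explSet_of_agree_on_block hagree).antisymm
    (explSet_subset_explSet_of_agree_on_block fun e he => (hagree e he).symm)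

/-- Configurations agreeing on the edges touching `Blk`, none of which has an open edge from `In`
out of `In ∪ Blk`, have the same rim: a rim edge issues either from `Blk` or from `In`, and in the
latter case it ends in `Blk`. [cite: BasuSapozhnikov2017ECP, §2, paragraph after eq. (2.3)] -/
theorem explRim_eq_of_agree_on_block {In Blk : Set V} {ω₁ ω₂ : BondConfig V}
    (hIn : ∀ u ∈ In, ∀ v : V, s(u, v) ∈ ω₁ ∪ ω₂ → v ∈ In ∪ Blk)
    (hagree : ∀ e : Sym2 V, (∃ v ∈ Blk, v ∈ e) → (e ∈ ω₁ ↔ e ∈ ω₂)) :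
    explRim In Blk ω₁ = explRim In Blk ω₂ := by
  have hE : explSet In Blk ω₁ = explSet In Blk ω₂ := explSet_eq_of_agree_on_block hagree
  have key : ∀ v ∈ explSet In Blk ω₁, ∀ w ∉ explSet In Blk ω₁, (s(v, w) ∈ ω₁ ↔ s(v, w) ∈ ω₂) := by
    intro v hv w hw
    rcases explSet_subset In Blk ω₁ hv with hvIn | hvBlk
    · have hwBlk : s(v, w) ∈ ω₁ ∪ ω₂ → w ∈ Blk := fun h =>
        (hIn v hvIn w h).resolve_left fun hwIn => hw (subset_explSet In Blk ω₁ hwIn)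
      exact ⟨fun h => (hagree _ ⟨w, hwBlk (Or.inl h), Sym2.mem_mk_right v w⟩).1 h,
        fun h => (hagree _ ⟨w, hwBlk (Or.inr h), Sym2.mem_mk_right v w⟩).2 h⟩
    · exact hagree _ ⟨v, hvBlk, Sym2.mem_mk_left v w⟩
  ext w
  rw [mem_explRim_iff, mem_explRim_iff, ← hE]
  exact and_congr_right fun hw => exists_congr fun v => and_congr_right fun hv => key v hv w hw

/-- **(E3) The datum event is determined by the edges touching `Blk`**, for configurations without
an open edge from `In` out of `In ∪ Blk`.
[cite: BasuSapozhnikov2017ECP, §2, paragraph after eq. (2.3)] -/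
theorem mem_explEvent_iff_of_agree_on_block {In Blk U R : Set V} {ω₁ ω₂ : BondConfig V}
    (hIn : ∀ u ∈ In, ∀ v : V, s(u, v) ∈ ω₁ ∪ ω₂ → v ∈ In ∪ Blk)
    (hagree : ∀ e : Sym2 V, (∃ v ∈ Blk, v ∈ e) → (e ∈ ω₁ ↔ e ∈ ω₂)) :
    ω₁ ∈ explEvent In Blk U R ↔ ω₂ ∈ explEvent In Blk U R := by
  rw [mem_explEvent_iff, mem_explEvent_iff, explSet_eq_of_agree_on_block (In := In) hagree,
    explRim_eq_of_agree_on_block hIn hagree]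

/-! ### (E5) A separating open-connected set inside the block wires the rim -/

/-- **(E5, wired form).** Let `P ⊆ Blk` be pairwise open-connected inside `In ∪ Blk` and meet
every open walk from `In` to the outside of `In ∪ Blk`. Then the rim is WIRED FROM INSIDE: a rim
vertex `r` carries an open edge from an explored vertex `x`; the exploring path `In → x` followed by
this edge meets `P` at a vertex `z ≠ r` (as `r ∉ Blk`), which is explored, and the piece `z → x`
runs inside the explored set; two such `z, z'` are joined inside `In ∪ Blk`, hence inside `𝒞`.
[cite: BasuSapozhnikov2017ECP, §2, paragraph after eq. (2.3)] -/
theorem explRimWired_of_separating {In Blk : Set V} {ω : BondConfig V} (P : Set V) (hP : P ⊆ Blk)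
    (hconn : ∀ a ∈ P, ∀ b ∈ P, ω ∈ openConnIn (In ∪ Blk) a b)
    (hsep : ∀ (u w : V), u ∈ In → w ∉ In ∪ Blk →
      ∀ p : (openGraph ω).Walk u w, ∃ z ∈ p.support, z ∈ P) :
    explRimWired In Blk ω := by
  classical
  have key : ∀ r ∈ explRim In Blk ω, ∃ x ∈ explSet In Blk ω, ∃ z ∈ P, s(x, r) ∈ ω ∧
      z ∈ explSet In Blk ω ∧ ω ∈ openConnIn (explSet In Blk ω) z x := by
    intro r hr
    obtain ⟨hrE, x, hx, hxr⟩ := mem_explRim_iff.1 hr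
    have hrIB : r ∉ In ∪ Blk := explRim_disjoint hr
    have hne : x ≠ r := fun h => hrE (h ▸ hx)
    obtain ⟨-, u, hu, hux⟩ := mem_explSet_iff_exists.1 hx
    obtain ⟨p, hp⟩ := exists_openWalk_of_mem_openConnIn hux
    have hadj : (openGraph ω).Adj x r := (openGraph_adj ω x r).2 ⟨hxr, hne⟩
    obtain ⟨z, hz, hzP⟩ := hsep u r hu hrIB (p.concat hadj)
    rw [Walk.support_concat, List.mem_append, List.mem_singleton] at hz
    rcases hz with hz | rfl
    · have huz : ω ∈ openConnIn (In ∪ Blk) u z :=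
        mem_openConnIn_of_mem_support p hp (fun _ he => mem_of_mem_walk_edges p he) hz
      have hzx : ω ∈ openConnIn (In ∪ Blk) z x := mem_openConnIn_of_walk (p.dropUntil z hz)
        (fun y hy => hp y (p.support_dropUntil_subset_support hz hy))
        fun _ he => mem_of_mem_walk_edges _ he
      have hzE : z ∈ explSet In Blk ω := Or.inr ⟨hP hzP, u, hu, huz⟩
      exact ⟨x, hx, z, hzP, hxr, hzE, openConnIn_explSet_of_mem_explSet hzE hzx⟩
    · exact absurd (Or.inr (hP hzP)) hrIB
  intro r hr r' hr'
  obtain ⟨x, hx, z, hzP, hxr, hzE, hzx⟩ := key r hr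
  obtain ⟨x', hx', z', hz'P, hx'r', -, hz'x'⟩ := key r' hr'
  exact ⟨x, hx, x', hx', hxr, hx'r', PlanarDuality.openConnIn_trans (openConnIn_reverse hzx)
    (PlanarDuality.openConnIn_trans (openConnIn_explSet_of_mem_explSet hzE (hconn z hzP z' hz'P))
      hz'x')⟩

/-- A rim wired from inside is linked: prepend and append the two open edges to the rim.
[cite: BasuSapozhnikov2017ECP, §2, paragraph after eq. (2.3)] -/
theorem explRimLinked_of_explRimWired {In Blk : Set V} {ω : BondConfig V}
    (h : explRimWired In Blk ω) : explRimLinked In Blk ω := by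
  intro r hr r' hr'
  obtain ⟨v, hv, v', hv', hvr, hv'r', hvv'⟩ := h r hr r' hr'
  have hne : ∀ {a b : V}, a ∈ explSet In Blk ω → b ∈ explRim In Blk ω → a ≠ b :=
    fun ha hb h => (mem_explRim_iff.1 hb).1 (h ▸ ha)
  exact PlanarDuality.openConnIn_trans
    (openConnIn_reverse (openConnIn_of_adj (Or.inl hv) (Or.inr hr) hvr (hne hv hr)))
    (PlanarDuality.openConnIn_trans (openConnIn_mono Set.subset_union_left _ _ hvv')
      (openConnIn_of_adj (Or.inl hv') (Or.inr hr') hv'r' (hne hv' hr')))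

/-- **(E5) A separating open-connected set inside the block links the rim.**
[cite: BasuSapozhnikov2017ECP, §2, paragraph after eq. (2.3)] -/
theorem explRimLinked_of_separating {In Blk : Set V} {ω : BondConfig V} (P : Set V) (hP : P ⊆ Blk)
    (hconn : ∀ a ∈ P, ∀ b ∈ P, ω ∈ openConnIn (In ∪ Blk) a b)
    (hsep : ∀ (u w : V), u ∈ In → w ∉ In ∪ Blk →
      ∀ p : (openGraph ω).Walk u w, ∃ z ∈ p.support, z ∈ P) :
    explRimLinked In Blk ω :=
  explRimLinked_of_explRimWired (explRimWired_of_separating P hP hconn hsep)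

/-! ### (E7) Decomposition of a connection at the explored set -/

/-- **(E7) Decomposition of `{x ↔ t}` on the datum event.** On `explEvent In Blk U R` with linked
rim, for `x ∈ U` and `t ∉ U`: `x ↔ t` iff (i) `x` is joined inside `U` to a vertex `v ∈ U` carrying
an open edge to a rim vertex (the piece of an open path before its FIRST exit from `U`; the exit
edge ends in the rim) and (ii) some rim vertex is joined to `t` by an open path avoiding `U` (the
piece after the LAST visit to `U`). Conversely such pieces are glued through the linked rim.
[cite: BasuSapozhnikov2017ECP, §2, paragraph after eq. (2.3)] -/
theorem openConn_iff_of_mem_explEvent {In Blk U R : Set V} {ω : BondConfig V}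
    (hω : ω ∈ explEvent In Blk U R) (hlink : explRimLinked In Blk ω) {x t : V} (hx : x ∈ U)
    (ht : t ∉ U) :
    ω ∈ openConn x t ↔
      (∃ w ∈ R, ∃ v ∈ U, ω ∈ openConnIn U x v ∧ s(v, w) ∈ ω) ∧ ∃ w ∈ R, ω ∈ openConnIn Uᶜ w t := by
  obtain ⟨rfl, rfl⟩ := mem_explEvent_iff.1 hω
  rw [mem_openConn_iff_openConnIn_univ]
  constructor
  · intro hxt
    rw [mem_openConnIn_iff_pathIn] at hxt
    constructor
    · -- the first exit from the explored set
      obtain ⟨a, b, ha, hb, -, hab, hxa⟩ := hxt.exit hx ht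
      rw [openGraph_adj] at hab
      refine ⟨b, (mem_explSet_or_explRim_of_open_edge ha hab.1).resolve_left hb, a, ha, ?_, hab.1⟩
      rw [mem_openConnIn_iff_pathIn]
      exact hxa.mono Set.inter_subset_left
    · -- the last visit to the explored set
      obtain ⟨a, b, ha, -, hb, hab, hbt⟩ := hxt.last_exit hx ht
      rw [openGraph_adj] at hab
      refine ⟨b, (mem_explSet_or_explRim_of_open_edge ha hab.1).resolve_left hb, ?_⟩
      rw [mem_openConnIn_iff_pathIn]
      exact hbt.mono fun z hz => hz.2
  · rintro ⟨⟨w, hw, v, hv, hxv, hvw⟩, w', hw', hw't⟩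
    -- glue `x → v`, the edge `v w`, the linked rim `w → w'` and `w' → t`
    have hne : v ≠ w := fun h => (mem_explRim_iff.1 hw).1 (h ▸ hv)
    have univ : ∀ {S : Set V} {a b : V}, ω ∈ openConnIn S a b → ω ∈ openConnIn Set.univ a b :=
      fun h => openConnIn_mono (Set.subset_univ _) _ _ h
    exact PlanarDuality.openConnIn_trans (univ hxv) (PlanarDuality.openConnIn_trans
      (openConnIn_of_adj trivial trivial hvw hne) (PlanarDuality.openConnIn_trans
        (univ (hlink w hw w' hw')) (univ hw't)))

end Literature.Probability.Percolation
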